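import Mathlib
import HarnessLib

/-!
# Wilf–Zeilberger summation with vanishing boundary terms

Topic `Literature/NumberTheory/ZetaValues`. The summation principle behind the WZ proofs of Apéry-like series
(Amdeberhan–Zeilberger 1997; used in this directory by `KoecherZetaFiveProofs.lean` and
`AlmkvistGranvilleZetaSevenProofs.lean`, which carry private copies, and by the Cohen–Rivoal proofs file):

Kh. Hessami Pilehrood, T. Hessami Pilehrood, *Generating function identities for `ζ(2n+2)`, `ζ(2n+3)` via the WZ
method*, Electron. J. Combin. **15** (2008) #R35 = arXiv:0801.1591, §1:
"**Proposition 1.** ([Amdeberhan–Zeilberger]) For any WZ pair `(F, G)`" — i.e. `F(n+1,k) − F(n,k) = G(n,k+1) − G(n,k)` —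
"`Σ_{k≥0} F(0,k) − lim_{n→∞} Σ_{k=0}^{n} F(n,k) = Σ_{n≥0} G(n,0) − lim_{k→∞} Σ_{n=0}^{k} G(n,k)`, whenever both sides
converge."

Typed here in the form in which it is used (both boundary limits zero, stated through the natural sufficient
conditions): if every row `F(n,·)` is summable, `G(n,k) → 0` as `k → ∞` for each `n`, `Σ_k F(n,k) → 0` as `n → ∞`,
and `G(·,0)` is summable, then `Σ_k F(0,k) = Σ_n G(n,0)`; together with the finite telescoped identity
`Σ_{k<K} (F(n+1,k) − F(n,k)) = G(n,K) − G(n,0)`. Values in any normed commutative group (`ℝ`, `ℂ`).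
-/

open Finset Filter Topology

namespace Literature.NumberTheory.ZetaValues

/-- The finite telescoped form of the WZ relation: `Σ_{k<K} (F(n+1,k) − F(n,k)) = G(n,K) − G(n,0)`.
[cite: HessamiPilehrood2008WZ, §1 Proposition 1 (proof; after Amdeberhan–Zeilberger)] -/
theorem wz_sum_range_sub {E : Type*} [AddCommGroup E] {F G : ℕ → ℕ → E}
    (hWZ : ∀ n k, F (n + 1) k - F n k = G n (k + 1) - G n k) (n K : ℕ) :
    ∑ k ∈ range K, (F (n + 1) k - F n k) = G n K - G n 0 := by
  rw [sum_congr rfl fun k _ => hWZ n k]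
  exact sum_range_sub (G n) K

/-- **WZ summation with vanishing boundary terms** (Amdeberhan–Zeilberger; [HessamiPilehrood2008WZ, Prop. 1] in the
case where both boundary limits are `0`): if `F(n+1,k) − F(n,k) = G(n,k+1) − G(n,k)` for all `n, k`, every `F(n,·)`
is summable, `G(n,k) → 0` as `k → ∞`, `Σ_k F(n,k) → 0` as `n → ∞`, and `G(·,0)` is summable, then
`Σ_k F(0,k) = Σ_n G(n,0)`. [cite: HessamiPilehrood2008WZ, §1 Proposition 1] -/
theorem wz_tsum_eq_tsum {E : Type*} [NormedAddCommGroup E] {F G : ℕ → ℕ → E}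
    (hWZ : ∀ n k, F (n + 1) k - F n k = G n (k + 1) - G n k)
    (hF : ∀ n, Summable (F n)) (hG : ∀ n, Tendsto (G n) atTop (𝓝 0))
    (hlim : Tendsto (fun n => ∑' k, F n k) atTop (𝓝 0)) (hG0 : Summable fun n => G n 0) :
    ∑' k, F 0 k = ∑' n, G n 0 := by
  -- `T(n+1) − T(n) = −G(n,0)` for `T(n) = Σ_k F(n,k)`
  have hstep : ∀ n, ∑' k, F (n + 1) k - ∑' k, F n k = -G n 0 := by
    intro n
    have h1 : Tendsto (fun K => ∑ k ∈ range K, (F (n + 1) k - F n k)) atTop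
        (𝓝 (∑' k, F (n + 1) k - ∑' k, F n k)) := by
      simp only [sum_sub_distrib]
      exact (hF (n + 1)).hasSum.tendsto_sum_nat.sub (hF n).hasSum.tendsto_sum_nat
    have h2 : Tendsto (fun K => ∑ k ∈ range K, (F (n + 1) k - F n k)) atTop (𝓝 (0 - G n 0)) := by
      simp only [wz_sum_range_sub hWZ]
      exact (hG n).sub tendsto_const_nhds
    rw [tendsto_nhds_unique h1 h2, zero_sub]
  -- `T(N) − T(0) = −Σ_{n<N} G(n,0)`, then `N → ∞`
  have hsum : ∀ N, ∑' k, F N k - ∑' k, F 0 k = -∑ n ∈ range N, G n 0 := fun N => by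
    rw [← sum_range_sub (fun n => ∑' k, F n k) N, sum_congr rfl fun n _ => hstep n, sum_neg_distrib]
  have h3 : Tendsto (fun N => ∑' k, F N k - ∑' k, F 0 k) atTop (𝓝 (0 - ∑' k, F 0 k)) :=
    hlim.sub tendsto_const_nhds
  simp only [hsum] at h3
  have h4 : Tendsto (fun N => -∑ n ∈ range N, G n 0) atTop (𝓝 (-∑' n, G n 0)) :=
    hG0.hasSum.tendsto_sum_nat.neg
  have h := tendsto_nhds_unique h3 h4
  rwa [zero_sub, neg_inj] at h

end Literature.NumberTheory.ZetaValues
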